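import Literature.MathematicalPhysics.QuantumFieldTheory.Balaban1983to89.B8Eq151V2Divergence

/-!
# `Balaban1983to89.B8Eq155JBound` — B8 Sect. C (1.55): the bound on `J = D^{η*}_{U₀}D^η_{U₀}A` from (1.54) and
# (1.40), in the pointwise form and in the scaled norm `|J|_(−3) ≦ 2α₀ + 36dα₂|∇^η_{U₀}A|_(−2) + 50dα₂³ + 10dα₀α₂`,
# its feed into the tree's (1.59)–(1.60) bootstrap, and the Hermitian case of (1.41)

CITATION HEADER (lean-in-tree rule 2026-08-18).  Kernel certificate written by the B08 owner lineage
(`b2b-balaban-b08`, generation 26) of the audit cell `pub-balaban` for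

* **B8** = T. Bałaban, *Spaces of regular gauge field configurations on a lattice and gauge fixing conditions*,
  Commun. Math. Phys. **99** (1985) 75–102 [cite key `Balaban1985RegularSpaces`; printed page = PDF page + 74;
  renders READ AS IMAGES by this unit: `1985-cmp99-regular-spaces-gauge-fixing-p003/p009/p010/p011/p012-x4.png` =
  printed pp. 77, 83, 84, 85, 86],
* with the unitary-group inequality (24) of **B7** = T. Bałaban, *Averaging operations for lattice gauge theories*,
  Commun. Math. Phys. **98** (1985) 17–51 = reference [3] of B8 [cite key `Balaban1985Averaging`; printed page = PDF
  page + 16; render READ AS IMAGE: `1985-cmp98-averaging-p005-x4.png` = printed p. 21, (19), (23)–(24)], in the form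
  already in the tree (`B8Ineq170.norm_exp_I_smul_sub_one_le`, `B7Prop2Explicit.unitaryUnits_le_U1`),

on top of the parent module `B8Eq151V2Divergence` (the gathering (1.54): `eq154` sharp / `eq154_printed` with the
printed constants `36d`, `50d`, `10d`; `norm_eta_smul_covDerivFwd_le`) and its parents `B8Eq146AExpansion`
(`plaqCovDeriv` = B9 (3.4) `(D^η_{U₀}A)(p)`, `lin = Σᵢxᵢ = η(D^η_{U₀}A)(p)`, `expCfg B = e^{B}`, `iEta η A = iηA`),
`B8Eq143PlaqExpansion` (`pdiv` = (1.2) for a general plaquette function), `B8Ineq132` (`covDeriv`, `covDerivFwd` =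
(1.1), `covDiv` = (1.2) `D^{η*}_U∂U`, `plaqF` = `U(∂p)`) and the tree's summary module `B8` (`B8.apriori_160` = the
real-arithmetic bootstrap (1.55) + (1.56) + (1.59) ⇒ (1.60)).  Nothing in this module is cited FROM the manuscript
as a fact: (1.55) enters only as the STATEMENT of kernel-proved theorems over the parent modules' definitions, the
norms `|·|_(α)` only as a DEFINITION, and (1.56), (1.59) only as real HYPOTHESES of the glue theorem of §4 — the
ABSOLUTE RULE of the cell (no internally-minted statement enters as a cited fact; the manuscript under audit is not
citable for its own steps).  Both papers are UNDER ADJUDICATION by the cell; nothing of them is asserted here.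

## The printed texts (verbatim, from the renders)

* B8 p. 77 [PDF 3], the spaces of regular configurations: «Now we can introduce the following spaces of regular
  field configurations: for a sequence (1.3) and a positive number α₀ we define 𝔄_k({Ω_j}, α₀) as a set of all
  gauge field configurations U on T_η satisfying the conditions
  |U(∂p) − 1| < α₀L^{−2j} for p ∈ Ω_j, j = 0, 1, …, k, (1.7)
  or |U(∂p) − 1| < α₀η²(Lʲη)⁻² for p ⊂ Ω_j, (1.8)
  |(D^{η*}_U ∂U)(b)| < α₀L^{−2j}(Lʲη)⁻¹ for b ∈ Ω_j, j = 0, 1, …, k. (1.9)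
  We have denoted U(∂p) = (∂U)(p).»
* B8 p. 83 [PDF 9], the assumptions of Sect. C: «Let us consider a somewhat more general situation. We assume that
  we have configurations U₀, U₁U₀ satisfying the following conditions
  U₀, U₁U₀ ∈ 𝔄_k({Ω_j}, α₀), U₀ satisfies the additional regularity condition (3.35) in [4], (1.40)
  U₁ = e^{iηA}, |A| < α₂(Lʲη)⁻¹ on Ω_j, (1.41)
  R(U₀)D^{η*}_{U₀}A = 0, Q_j(U₀, ηA) = B on Λ_j, |B| < 2dLα₁, (1.42)».
* B8 p. 85 [PDF 11], after (1.49): «This equality holds for arbitrary A in the complexified Lie algebra, but if A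
  is Hermitian, then the first expression above is a real part of V₂, and the second is an imaginary part of V₂,
  multiplied by i.»
* B7 p. 21 [PDF 5], (23)–(24): «log U = i Σ_{j=1}^{r} λ_jP_j = iA, (23) A is a hermitian matrix, |A| ≦ π. From this
  definition the following inequalities follow:
  |U − 1| = max_j|e^{iλ_j} − 1| = max_j|sin(λ_j/2)/(λ_j/2)||λ_j| ≦ max_j|λ_j| = |log U|, (24)» (the operator norm (19)
  «|X| = sup|Xψ| = sup|φ̄·Xψ|, φ, ψ ∈ ℂ^N, |φ| = |ψ| = 1»).
* B8 p. 86 [PDF 12], after (1.54): «This is the basic estimate. It will be applied in several different situations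
  in the future. Let us recall that it was derived under the assumption (0.1) for U₀ and (1.41) for U₁.
  We will apply it to get regularity results for A, assuming (1.40)–(1.42). From (1.40) the term on the left-hand
  side and the first term on the right-hand side can be estimated by α₀(Lʲη)⁻³η². This implies that
  D^{η*}_{U₀}D^η_{U₀}A = J,
  |J| ≦ (2α₀ + 36dα₂(Lʲη)²|∇^η_{U₀}A| + 50dα₂³ + 10dα₀α₂)(Lʲη)⁻³, (1.55)
  or
  |J|_(−3) ≦ 2α₀ + 36dα₂|∇^η_{U₀}A|_(−2) + 50dα₂³ + 10dα₀α₂,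
  where the norms |·|_(α) were introduced in [4]. For the reader's convenience let us recall the definition:
  |A|_(α) = sup_j sup_{Ω_j}(Lʲη)^{−α}|A|.»  and, further down the same page: «Theorem 3.3 of [4] implies the
  bounds: |A|_(−1), |∇^η_{U₀}A|_(−2), |D^{η*}_{U₀}D^η_{U₀}A|_(−3), |Δ^η_{U₀}A|_(−3) ≦ B₀(|J|_(−3) + |B₁|)
  ≦ B₀(2α₀ + 36dα₂|∇^η_{U₀}A|_(−2) + 50dα₂³ + 10dα₀α₂ + 2dLα₁ + C₂α₂²). (1.59)
  Let us take this bound for |∇^η_{U₀}A|_(−2) on the left-hand side, and let us assume that B₀36dα₂ ≦ 1/2. This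
  gives us a bound for |∇^η_{U₀}A|_(−2), equal to the right-hand side above without this term and multiplied by
  2. Using this bound we get
  |A|_(−1), |∇^η_{U₀}A|_(−2), |D^{η*}_{U₀}D^η_{U₀}A|_(−3), |Δ^η_{U₀}A|_(−3) < B₀(4α₀ + 4dLα₁ + 2α₂² + 20dα₀α₂ + 2C₂α₂²).
  (1.60)» (with, between them, (1.56) «|B₁| < 2dLα₁ + C₂α₂²», (1.57), (1.58) and the definition of `G(U₀)` — not
  typed here, see HONEST SCOPE).

## Dictionary (the `ℤ^d` model of the parent modules; additions of this module in **bold**)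

Sites `Site d = Fin d → ℤ` (lattice spacing = the explicit `η > 0`), bond fields `A, B : Site d → Fin d → 𝔸` over a
normed `ℂ`-algebra `𝔸` with `‖1‖ = 1` (complete where `e^{B}` occurs; a C⋆-algebra in §5), `A y κ = A(y, y + e_κ)`;
`U₀` is `U1`-valued (`‖u‖ ≤ 1 ∧ ‖u⁻¹‖ ≤ 1` ⊇ `U(N)`).
* print's `J = D^{η*}_{U₀}D^η_{U₀}A` (the bond function of (1.55)) ↦ **`Jcur η U₀ A μ x`** `= pdiv η U₀ (plaqCovDeriv η
  U₀ A) μ x`: the divergence (1.2) (`pdiv`, `D^{η*}_{U₀}` on plaquette functions) of the plaquette covariant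
  derivative B9 (3.4) (`plaqCovDeriv`, `(D^η_{U₀}A)(p) = η⁻¹Σᵢxᵢ`) at the bond `⟨x, x + e_μ⟩`; the parent's (1.54)
  (`eq154_printed`) is literally `|D^{η*}_{U₁U₀}∂(U₁U₀) − D^{η*}_{U₀}∂U₀ − iη²·J| ≤ …`;
* «From (1.40) the term on the left-hand side and the first term on the right-hand side can be estimated by
  α₀(Lʲη)⁻³η²» ↦ the two HYPOTHESES **`h40₁ : ‖covDiv η (mulCfg (expCfg (iEta η A)) U₀) μ x‖ ≤ α₀η²((Lʲη)⁻¹)³`** and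
  **`h40₀ : ‖covDiv η U₀ μ x‖ ≤ α₀η²((Lʲη)⁻¹)³`** = (1.9) for `U = U₁U₀` and `U = U₀` («U₀, U₁U₀ ∈ 𝔄_k({Ω_j}, α₀)»,
  (1.40)) in the units of (1.8): `α₀L^{−2j}(Lʲη)⁻¹ = α₀η²(Lʲη)⁻³` exactly as print rewrites (1.7) into (1.8)
  (`L^{−2j} = η²(Lʲη)⁻²`); weak `≤` for print's `<`;
* `|∇^η_{U₀}A|` ↦ as in the parent, a common bound `G` of all components `‖(D^η_{U₀,κ}A_τ)(y)‖` (`hG : ∀ y κ τ,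
  ‖covDerivFwd η U₀ κ (fun z ↦ A z τ) y‖ ≤ G`); any larger gradient norm satisfies the certified inequalities a fortiori
  (they are monotone in `G`);
* the norms «|A|_(α) = sup_j sup_{Ω_j}(Lʲη)^{−α}|A|» AT ONE LEVEL `j` AND GLOBALLY (`Ω_j` ↦ all of `ℤ^d`, see HONEST
  SCOPE (ii)) ↦ **`wsup w F = ⨆ i, w·‖F i‖`** (a real `iSup`, `= 0` on an unbounded family — never the case below) with
  the weight `w = (Lʲη)^{−α}`:  **`jNorm3 η L j U₀ A`** `= sup_{μ,x}(Lʲη)³|J_μ(x)|` = `|J|_(−3)` at level `j`,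
  **`gradNorm2 η L j U₀ A`** `= sup_{κ,τ,y}(Lʲη)²|(D^η_{U₀,κ}A_τ)(y)|` = `|∇^η_{U₀}A|_(−2)` at level `j`;
* `r = (Lʲη)⁻¹` ↦ `((L : ℝ) ^ j * η)⁻¹`; `B = iηA` ↦ `iEta η A`; `U₁ = e^{iηA}` ↦ `expCfg (iEta η A)`; «if A is
  Hermitian» (p. 85; B7 p. 21 «A is a hermitian matrix») ↦ **`IsSelfAdjoint (A y κ)`** for every bond, in a
  C⋆-algebra (§5; print: `M_N(ℂ)` with the operator norm (19)).

## What is certified (kernel, `sorry`-free; axioms `propext` / `Classical.choice` / `Quot.sound`)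

§1 [folklore] the reverse-triangle step «This implies that»: `|c·J| ≤ |T₀| + |T₁| + |T₀ − T₁ − c·J|` and
`|iη²·J| = η²|J|`.  §2 **(1.55), SHARP, GENERAL EXPONENT FIELD** (`eq155`): for `U1`-valued `U₀`, `U₁ = e^{B}`
`U1`-valued, `|B| ≤ a`, `|∇B| ≤ G`, `|U₁ − 1| ≤ u`, `|U₀(∂p) − 1| ≤ p`, `|D^{η*}_{U₁U₀}∂(U₁U₀)_μ(x)| ≤ t₁`,
`|D^{η*}_{U₀}∂U₀,_μ(x)| ≤ t₀`:  `|D^{η*}_{U₀}(Σᵢxᵢ)_μ(x)| ≤ t₁ + t₀ + 36(d − 1)aG + (d − 1)η⁻¹Φ(a) + 2(d − 1)η⁻¹ρ₃(4a) +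
10(d − 1)η⁻¹up` (from the parent's `eq154`);  **(1.55) AS PRINTED, FIRST FORM** (`eq155_printed`): under the hypotheses
of `eq154_printed` (`U₁ = e^{iηA}` `U1`-valued, `|U₁ − 1| ≤ α₂(Lʲη)⁻¹η`, `|A| ≤ α₂(Lʲη)⁻¹`, `|∇^η_{U₀}A| ≤ G`, `|U₀(∂p) − 1|
≤ α₀η²(Lʲη)⁻²`, `α₀, α₂ ≥ 0`, `η > 0`, smallness `16α₂(Lʲη)⁻¹η ≤ 1 ∧ 5α₂(Lʲη)⁻¹η(d − 1) ≤ 4`) plus `h40₀`, `h40₁`: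
`|J_μ(x)| ≤ (2α₀ + 36dα₂(Lʲη)²G + 50dα₂³ + 10dα₀α₂)(Lʲη)⁻³` at every bond — print's display, letter for letter (the
`η²` of (1.54) and of `α₀(Lʲη)⁻³η²` cancel against the `η²` of `iη²J`); the same with the factor `(Lʲη)³` moved to
the left (`eq155_scaled`, `L ≥ 1`).  §3 THE NORMS: `wsup` and its three working lemmas (`wsup_le`, `le_wsup`,
`wsup_nonneg`); the gradient is bounded by (1.41) alone, `|(D^η_{U₀,κ}A_τ)(y)| ≤ 2η⁻¹·sup|A|`
(`norm_covDerivFwd_le_of_141`), so `|∇^η_{U₀}A|_(−2)` is a genuine supremum (`le_gradNorm2`); **(1.55), SECOND FORM**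
(`eq155_norm`): `|J|_(−3) ≤ 2α₀ + 36dα₂|∇^η_{U₀}A|_(−2) + 50dα₂³ + 10dα₀α₂` (level `j`, global), from the first form
at `G = (Lʲη)⁻²|∇^η_{U₀}A|_(−2)`.  §4 THE FEED INTO (1.59) ⇒ (1.60) (`apriori_160_of_155`): with `|J|_(−3)`,
`|∇^η_{U₀}A|_(−2)` THESE certified suprema, (1.56) `|B₁| ≤ 2dLα₁ + C₂α₂²` and the four Theorem-3.3-of-[4] bounds (1.59)
`… ≤ B₀(|J|_(−3) + |B₁|)` as real HYPOTHESES, and «B₀36dα₂ ≦ 1/2», `50dα₂ ≤ 1` (the unprinted side condition of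
the tree's `B8.apriori_160`, making `100dα₂³ ≤ 2α₂²`): the four bounds (1.60), in particular `|∇^η_{U₀}A|_(−2) ≤ B₀(4α₀ + 4dLα₁ + 2α₂² + 20dα₀α₂ + 2C₂α₂²)` —
i.e. the kernel (1.55) has exactly the shape the tree's bootstrap consumes.  §5 THE HERMITIAN CASE OF (1.41), in a
C⋆-algebra with `‖1‖ = 1`: for `A(b)` self-adjoint, `e^{iηA(b)}` is unitary, hence `U1`-valued
(`expCfg_iEta_mem_U1`), and `|e^{iηA(b)} − 1| ≤ η|A(b)| ≤ α₂(Lʲη)⁻¹η` (`norm_expCfg_iEta_sub_one_le`, from (24) of [3]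
= `B8Ineq170.norm_exp_I_smul_sub_one_le`); so the two ASSUMED hypotheses `h₁`, `hu` of the parent's `eq154_printed`
and of `eq155_printed` / `eq155_norm` are DISCHARGED for Hermitian `A` (`eq154_hermitian`, `eq155_hermitian`,
`eq155_norm_hermitian`) — closing item (iv) of the parent's HONEST SCOPE.

## HONEST SCOPE — what is NOT claimed

(i) Inherited from the parent: `U₀` is `U1`-valued; print's `36d`, `10d`, `2α₀` are certified exactly (indeed `36d`
with `32(d − 1) + 4(d − 1)`), `50d` only under OUR explicit smallness `16a ≤ 1 ∧ 5a(d − 1) ≤ 4`, `a = ηα₂(Lʲη)⁻¹`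
(print: (1.41) and «α₀ + α₁ is sufficiently small», p. 83); the all-`d`, all-`a` statement is the sharp `eq155`.  (ii) THE
NORMS ARE ONE-LEVEL AND GLOBAL: print's `|·|_(α)` is `sup_j sup_{Ω_j}` with the level-dependent weight `(Lʲη)^{−α}` over
the sequence of domains (1.3); here `j` is a fixed parameter and the supremum runs over ALL bonds of `ℤ^d` (print
admits `Ω_j = T_η`, p. 77, but on the torus; the `ℤ^d` model and the boundary layers of `Ω_j` are the standing caveat
of the lineage, cell GAPS G-adv8-11) — the multi-level norm is the conjunction over `j` of the one-level statements
only when every hypothesis holds globally at every level, which is NOT print's situation.  (iii) (1.40)'s second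
clause («the additional regularity condition (3.35) in [4]») and (1.42) are not used by (1.55) and not typed; (1.9)
enters as the two hypotheses `h40₀`, `h40₁`, not derived from anything.  (iv) NOT typed: (1.56) (Proposition 4 of
[3] on `Q_j(U₀, ηA)`), the translation (1.57), (1.58), the operator `G(U₀)` and Theorem 3.3 of [4] — in §4 they are
the real hypotheses `h56`, `h59a`, `h59g`, `h59j`, `h59l` exactly as in the tree's `B8.apriori_160`, now with `nJ`,
`g` instantiated by certified suprema; (1.61) ff. are the tree's `B8.bootstrap_136`.  (v) §5 needs a C⋆-algebra
(print: `U(N) ⊂ M_N(ℂ)` with the operator norm, a C⋆-algebra); §§1–4 hold in any complete normed `ℂ`-algebra with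
`‖1‖ = 1`.  Print's strict `<` are certified as `≤`.  (vi) Nothing here is progress on the summit
`Summit.QuantumFields` — the value is a kernel section certificate for B8 (1.55) and its interface to (1.59)–(1.60).
-/

noncomputable section

open scoped BigOperators
open NormedSpace Finset

namespace Literature.MathematicalPhysics.QuantumFieldTheory.Balaban1983to89.B8Eq155JBound

open B7Prop1Explicit
open B7Eq78Linearization (conjR conjR_apply)
open B8Lemma1NonAbelian (mulCfg)
open B8Ineq132 (plaqF covDeriv covDerivFwd covDiv norm_conjR_le norm_conjR)
open B8Eq143PlaqExpansion
open B8Eq146AExpansion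
open B8Eq151V2Divergence

-- `Site` alone would resolve to the torus sites of `Setup.lean`; re-export the `ℤ^d` sites of `B7Prop1Explicit`.
export B7Prop1Explicit (Site)

variable {d : ℕ}

/-! ## §1 [folklore] The reverse-triangle step and the unit `|iη²J| = η²|J|` -/

section Folklore

variable {E : Type*} [SeminormedAddCommGroup E]

/-- «This implies that»: `|P| ≤ |T₁| + |T₀| + |T₁ − T₀ − P|`. [folklore] -/
theorem norm_le_of_norm_sub_sub_le {T₁ T₀ P : E} {t₁ t₀ R : ℝ} (h₁ : ‖T₁‖ ≤ t₁) (h₀ : ‖T₀‖ ≤ t₀)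
    (h : ‖T₁ - T₀ - P‖ ≤ R) : ‖P‖ ≤ t₁ + t₀ + R := by
  have e : P = T₁ - T₀ - (T₁ - T₀ - P) := by abel
  rw [e]
  calc ‖T₁ - T₀ - (T₁ - T₀ - P)‖ ≤ ‖T₁ - T₀‖ + ‖T₁ - T₀ - P‖ := norm_sub_le _ _
    _ ≤ ‖T₁‖ + ‖T₀‖ + ‖T₁ - T₀ - P‖ := by gcongr; exact norm_sub_le _ _
    _ ≤ t₁ + t₀ + R := by gcongr

variable [NormedSpace ℂ E]

/-- `|iη²·X| = η²|X|`. [folklore] -/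
theorem norm_I_eta_sq_smul (η : ℝ) (X : E) : ‖((Complex.I : ℂ) * η ^ 2) • X‖ = η ^ 2 * ‖X‖ := by
  rw [norm_smul, norm_mul, Complex.norm_I, one_mul, ← Complex.ofReal_pow, Complex.norm_real,
    Real.norm_of_nonneg (sq_nonneg η)]

/-- The units of (1.55): `(Lʲη)²·((Lʲη)⁻¹)³ = (Lʲη)⁻¹` (also at `Lʲη = 0`, where both sides vanish). [folklore] -/
theorem sq_mul_inv_cube (s : ℝ) : s ^ 2 * (s⁻¹) ^ 3 = s⁻¹ := by
  rcases eq_or_ne s 0 with h | h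
  · simp [h]
  · field_simp

end Folklore

/-! ## §2 (1.55) pointwise: the sharp form for a general exponent field and the printed first form -/

section Pointwise

variable {𝔸 : Type*} [NormedRing 𝔸] [NormOneClass 𝔸] [NormedAlgebra ℂ 𝔸] [CompleteSpace 𝔸]

omit [NormOneClass 𝔸] [CompleteSpace 𝔸] in
/-- print's `J = D^{η*}_{U₀}D^η_{U₀}A` of (1.55): the divergence (1.2) of the plaquette covariant derivative
B9 (3.4) of the bond field `A`, at the bond `⟨x, x + e_μ⟩`. [cite: Balaban1985RegularSpaces, (1.55) p.86] -/
def Jcur (η : ℝ) (U₀ : Site d → Fin d → 𝔸ˣ) (A : Site d → Fin d → 𝔸) (μ : Fin d) (x : Site d) : 𝔸 :=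
  pdiv η U₀ (plaqCovDeriv η U₀ A) μ x

omit [NormOneClass 𝔸] [CompleteSpace 𝔸] in
/-- Unfolding `J`. [folklore] -/
theorem Jcur_def (η : ℝ) (U₀ : Site d → Fin d → 𝔸ˣ) (A : Site d → Fin d → 𝔸) (μ : Fin d) (x : Site d) :
    Jcur η U₀ A μ x = pdiv η U₀ (plaqCovDeriv η U₀ A) μ x := rfl

/-- **(1.55), SHARP FORM, GENERAL EXPONENT FIELD.**  Under the hypotheses of the parent's `eq154` and the two
divergence bounds `|D^{η*}_{U₁U₀}∂(U₁U₀)_μ(x)| ≤ t₁`, `|D^{η*}_{U₀}∂U₀,_μ(x)| ≤ t₀` ((1.9) for `U₁U₀` and `U₀`):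
`|D^{η*}_{U₀}(Σᵢxᵢ)_μ(x)| ≤ t₁ + t₀ + 36(d − 1)aG + (d − 1)η⁻¹Φ(a) + 2(d − 1)η⁻¹ρ₃(4a) + 10(d − 1)η⁻¹up`.
[cite: Balaban1985RegularSpaces, (1.55) p.86] -/
theorem eq155 {η : ℝ} (hη : 0 < η) {U₀ : Site d → Fin d → 𝔸ˣ} (h₀ : ∀ y κ, U₀ y κ ∈ U1 𝔸)
    {B : Site d → Fin d → 𝔸} (h₁ : ∀ y κ, expCfg B y κ ∈ U1 𝔸) {a G u p t₁ t₀ : ℝ} (hB : ∀ y κ, ‖B y κ‖ ≤ a)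
    (hG : ∀ (y : Site d) (κ τ : Fin d), ‖covDerivFwd η U₀ κ (fun z => B z τ) y‖ ≤ G)
    (hu : ∀ y κ, ‖(expCfg B y κ : 𝔸) - 1‖ ≤ u)
    (hp : ∀ (y : Site d) (κ ν : Fin d), κ ≠ ν → ‖plaqF U₀ κ ν y - 1‖ ≤ p) (μ : Fin d) (x : Site d)
    (h40₁ : ‖covDiv η (mulCfg (expCfg B) U₀) μ x‖ ≤ t₁) (h40₀ : ‖covDiv η U₀ μ x‖ ≤ t₀) :
    ‖pdiv η U₀ (lin U₀ B) μ x‖ ≤ t₁ + t₀ + (36 * ((d : ℝ) - 1) * a * G + ((d : ℝ) - 1) * (η⁻¹ * phi146 a) +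
        2 * ((d : ℝ) - 1) * η⁻¹ * expRem3 (4 * a) + 10 * ((d : ℝ) - 1) * η⁻¹ * u * p) :=
  norm_le_of_norm_sub_sub_le h40₁ h40₀ (eq154 hη h₀ h₁ hB hG hu hp μ x)

/-- **(1.55) AS PRINTED, FIRST FORM.**  Under the hypotheses of the parent's `eq154_printed` and «From (1.40) the
term on the left-hand side and the first term on the right-hand side can be estimated by α₀(Lʲη)⁻³η²» (the
hypotheses `h40₁`, `h40₀` = (1.9) for `U₁U₀` and `U₀`):
`|J_μ(x)| ≤ (2α₀ + 36dα₂(Lʲη)²|∇^η_{U₀}A| + 50dα₂³ + 10dα₀α₂)(Lʲη)⁻³`. [cite: Balaban1985RegularSpaces, (1.55) p.86] -/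
theorem eq155_printed {η : ℝ} (hη : 0 < η) {U₀ : Site d → Fin d → 𝔸ˣ} (h₀ : ∀ y κ, U₀ y κ ∈ U1 𝔸)
    {A : Site d → Fin d → 𝔸} (h₁ : ∀ y κ, expCfg (iEta η A) y κ ∈ U1 𝔸) {L j : ℕ} {α₀ α₂ G : ℝ}
    (hα₀ : 0 ≤ α₀) (hα₂ : 0 ≤ α₂) (hA : ∀ y κ, ‖A y κ‖ ≤ α₂ * ((L : ℝ) ^ j * η)⁻¹)
    (hG : ∀ (y : Site d) (κ τ : Fin d), ‖covDerivFwd η U₀ κ (fun z => A z τ) y‖ ≤ G)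
    (hu : ∀ y κ, ‖(expCfg (iEta η A) y κ : 𝔸) - 1‖ ≤ α₂ * ((L : ℝ) ^ j * η)⁻¹ * η)
    (hp : ∀ (y : Site d) (κ ν : Fin d), κ ≠ ν → ‖plaqF U₀ κ ν y - 1‖ ≤ α₀ * η ^ 2 * (((L : ℝ) ^ j * η)⁻¹) ^ 2)
    (hsmall : 16 * (α₂ * ((L : ℝ) ^ j * η)⁻¹ * η) ≤ 1)
    (hd : 5 * (α₂ * ((L : ℝ) ^ j * η)⁻¹ * η) * ((d : ℝ) - 1) ≤ 4) (μ : Fin d) (x : Site d)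
    (h40₁ : ‖covDiv η (mulCfg (expCfg (iEta η A)) U₀) μ x‖ ≤ α₀ * η ^ 2 * (((L : ℝ) ^ j * η)⁻¹) ^ 3)
    (h40₀ : ‖covDiv η U₀ μ x‖ ≤ α₀ * η ^ 2 * (((L : ℝ) ^ j * η)⁻¹) ^ 3) :
    ‖Jcur η U₀ A μ x‖ ≤ (2 * α₀ + 36 * d * α₂ * (((L : ℝ) ^ j * η) ^ 2 * G) + 50 * d * α₂ ^ 3 +
        10 * d * α₀ * α₂) * (((L : ℝ) ^ j * η)⁻¹) ^ 3 := by
  set s : ℝ := (L : ℝ) ^ j * η with hs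
  set r : ℝ := s⁻¹ with hr
  have key := norm_le_of_norm_sub_sub_le h40₁ h40₀
    (eq154_printed hη h₀ h₁ hα₀ hα₂ hA hG hu hp hsmall hd μ x)
  rw [norm_I_eta_sq_smul] at key
  have hη2 : 0 < η ^ 2 := by positivity
  -- cancel the common factor `η²`
  have hJ : ‖Jcur η U₀ A μ x‖ ≤ 2 * α₀ * r ^ 3 + 36 * d * (α₂ * r) * G + 50 * d * α₂ ^ 3 * r ^ 3 +
      10 * d * α₀ * α₂ * r ^ 3 := by
    rw [Jcur_def, ← mul_le_mul_iff_right₀ hη2]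
    refine key.trans_eq ?_
    ring
  refine hJ.trans_eq ?_
  have hu := sq_mul_inv_cube s
  calc 2 * α₀ * r ^ 3 + 36 * d * (α₂ * r) * G + 50 * d * α₂ ^ 3 * r ^ 3 + 10 * d * α₀ * α₂ * r ^ 3
      = 2 * α₀ * r ^ 3 + 36 * d * α₂ * (s ^ 2 * r ^ 3) * G + 50 * d * α₂ ^ 3 * r ^ 3 +
          10 * d * α₀ * α₂ * r ^ 3 := by rw [hr, hu]; ring
    _ = _ := by ring

/-- **(1.55), FIRST FORM WITH THE WEIGHT ON THE LEFT** (`L ≥ 1`): `(Lʲη)³|J_μ(x)| ≤ 2α₀ + 36dα₂(Lʲη)²|∇^η_{U₀}A| + 50dα₂³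
+ 10dα₀α₂`. [cite: Balaban1985RegularSpaces, (1.55) p.86] -/
theorem eq155_scaled {η : ℝ} (hη : 0 < η) {U₀ : Site d → Fin d → 𝔸ˣ} (h₀ : ∀ y κ, U₀ y κ ∈ U1 𝔸)
    {A : Site d → Fin d → 𝔸} (h₁ : ∀ y κ, expCfg (iEta η A) y κ ∈ U1 𝔸) {L j : ℕ} (hL : 0 < L) {α₀ α₂ G : ℝ}
    (hα₀ : 0 ≤ α₀) (hα₂ : 0 ≤ α₂) (hA : ∀ y κ, ‖A y κ‖ ≤ α₂ * ((L : ℝ) ^ j * η)⁻¹)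
    (hG : ∀ (y : Site d) (κ τ : Fin d), ‖covDerivFwd η U₀ κ (fun z => A z τ) y‖ ≤ G)
    (hu : ∀ y κ, ‖(expCfg (iEta η A) y κ : 𝔸) - 1‖ ≤ α₂ * ((L : ℝ) ^ j * η)⁻¹ * η)
    (hp : ∀ (y : Site d) (κ ν : Fin d), κ ≠ ν → ‖plaqF U₀ κ ν y - 1‖ ≤ α₀ * η ^ 2 * (((L : ℝ) ^ j * η)⁻¹) ^ 2)
    (hsmall : 16 * (α₂ * ((L : ℝ) ^ j * η)⁻¹ * η) ≤ 1)
    (hd : 5 * (α₂ * ((L : ℝ) ^ j * η)⁻¹ * η) * ((d : ℝ) - 1) ≤ 4) (μ : Fin d) (x : Site d)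
    (h40₁ : ‖covDiv η (mulCfg (expCfg (iEta η A)) U₀) μ x‖ ≤ α₀ * η ^ 2 * (((L : ℝ) ^ j * η)⁻¹) ^ 3)
    (h40₀ : ‖covDiv η U₀ μ x‖ ≤ α₀ * η ^ 2 * (((L : ℝ) ^ j * η)⁻¹) ^ 3) :
    ((L : ℝ) ^ j * η) ^ 3 * ‖Jcur η U₀ A μ x‖ ≤
      2 * α₀ + 36 * d * α₂ * (((L : ℝ) ^ j * η) ^ 2 * G) + 50 * d * α₂ ^ 3 + 10 * d * α₀ * α₂ := by
  set s : ℝ := (L : ℝ) ^ j * η with hs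
  have hs0 : 0 < s := by positivity
  have h := eq155_printed hη h₀ h₁ hα₀ hα₂ hA hG hu hp hsmall hd μ x h40₁ h40₀
  have h3 : 0 < s ^ 3 := by positivity
  have e : s ^ 3 * (s⁻¹) ^ 3 = 1 := by rw [← mul_pow, mul_inv_cancel₀ hs0.ne', one_pow]
  calc s ^ 3 * ‖Jcur η U₀ A μ x‖
      ≤ s ^ 3 * ((2 * α₀ + 36 * d * α₂ * (s ^ 2 * G) + 50 * d * α₂ ^ 3 + 10 * d * α₀ * α₂) * (s⁻¹) ^ 3) :=
        mul_le_mul_of_nonneg_left h h3.le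
    _ = (2 * α₀ + 36 * d * α₂ * (s ^ 2 * G) + 50 * d * α₂ ^ 3 + 10 * d * α₀ * α₂) * (s ^ 3 * (s⁻¹) ^ 3) := by
        ring
    _ = _ := by rw [e, mul_one]

end Pointwise

/-! ## §3 The norms `|·|_(α)` at one level (global) and (1.55), second form -/

section Norms

variable {E : Type*} [SeminormedAddCommGroup E] {ι : Type*}

/-- ONE LEVEL of print's «|A|_(α) = sup_j sup_{Ω_j}(Lʲη)^{−α}|A|»: the weighted supremum `sup_i w·|F i|` of a family
(`w = (Lʲη)^{−α}`; a real `iSup`, so `0` on an unbounded family). [cite: Balaban1985RegularSpaces, p.86 (definition after (1.55))] -/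
def wsup (w : ℝ) (F : ι → E) : ℝ := ⨆ i, w * ‖F i‖

/-- A uniform bound of the weighted family bounds the weighted sup (no non-emptiness needed: `c ≥ 0`). [folklore] -/
theorem wsup_le {w c : ℝ} {F : ι → E} (h : ∀ i, w * ‖F i‖ ≤ c) (hc : 0 ≤ c) : wsup w F ≤ c :=
  Real.iSup_le h hc

/-- Each member of a uniformly bounded weighted family is below the weighted sup. [folklore] -/
theorem le_wsup {w c : ℝ} {F : ι → E} (h : ∀ i, w * ‖F i‖ ≤ c) (i : ι) : w * ‖F i‖ ≤ wsup w F :=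
  le_ciSup (f := fun k => w * ‖F k‖) ⟨c, by rintro _ ⟨k, rfl⟩; exact h k⟩ i

/-- The weighted sup is non-negative for a non-negative weight. [folklore] -/
theorem wsup_nonneg {w : ℝ} (hw : 0 ≤ w) (F : ι → E) : 0 ≤ wsup w F :=
  Real.iSup_nonneg fun _ => mul_nonneg hw (norm_nonneg _)

variable {𝔸 : Type*} [NormedRing 𝔸] [NormOneClass 𝔸] [NormedAlgebra ℂ 𝔸] [CompleteSpace 𝔸]

omit [NormOneClass 𝔸] [CompleteSpace 𝔸] in
/-- `|J|_(−3)` AT LEVEL `j`, GLOBALLY: `sup_{μ,x}(Lʲη)³|J_μ(x)|`. [cite: Balaban1985RegularSpaces, (1.55) p.86] -/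
def jNorm3 (η : ℝ) (L j : ℕ) (U₀ : Site d → Fin d → 𝔸ˣ) (A : Site d → Fin d → 𝔸) : ℝ :=
  wsup (((L : ℝ) ^ j * η) ^ 3) (fun b : Fin d × Site d => Jcur η U₀ A b.1 b.2)

omit [NormOneClass 𝔸] [CompleteSpace 𝔸] in
/-- `|∇^η_{U₀}A|_(−2)` AT LEVEL `j`, GLOBALLY: `sup_{κ,τ,y}(Lʲη)²|(D^η_{U₀,κ}A_τ)(y)|` (all components of the forward
covariant gradient (1.1)). [cite: Balaban1985RegularSpaces, (1.55) p.86; (1.1) p.76] -/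
def gradNorm2 (η : ℝ) (L j : ℕ) (U₀ : Site d → Fin d → 𝔸ˣ) (A : Site d → Fin d → 𝔸) : ℝ :=
  wsup (((L : ℝ) ^ j * η) ^ 2) (fun t : Fin d × Fin d × Site d => covDerivFwd η U₀ t.1 (fun z => A z t.2.1) t.2.2)

omit [NormOneClass 𝔸] [CompleteSpace 𝔸] in
/-- `|J|_(−3) ≥ 0`. [folklore] -/
theorem jNorm3_nonneg {η : ℝ} (hη : 0 ≤ η) (L j : ℕ) (U₀ : Site d → Fin d → 𝔸ˣ) (A : Site d → Fin d → 𝔸) :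
    0 ≤ jNorm3 η L j U₀ A :=
  wsup_nonneg (by positivity) _

omit [NormOneClass 𝔸] [CompleteSpace 𝔸] in
/-- `|∇^η_{U₀}A|_(−2) ≥ 0`. [folklore] -/
theorem gradNorm2_nonneg (η : ℝ) (L j : ℕ) (U₀ : Site d → Fin d → 𝔸ˣ) (A : Site d → Fin d → 𝔸) :
    0 ≤ gradNorm2 η L j U₀ A :=
  wsup_nonneg (sq_nonneg _) _

omit [CompleteSpace 𝔸] in
/-- (1.41) ALONE BOUNDS THE GRADIENT: `|(D^η_{U₀,κ}A_τ)(y)| ≤ η⁻¹·2α₂(Lʲη)⁻¹` for `U1`-valued `U₀`, `|A| ≤ α₂(Lʲη)⁻¹`,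
`η > 0` (`|ηD_κA_τ| ≤ 2|A|`). [cite: Balaban1985RegularSpaces, (1.1) p.76, (1.41) p.83] -/
theorem norm_covDerivFwd_le_of_141 {η : ℝ} (hη : 0 < η) {U₀ : Site d → Fin d → 𝔸ˣ} (h₀ : ∀ y κ, U₀ y κ ∈ U1 𝔸)
    {A : Site d → Fin d → 𝔸} {α : ℝ} (hA : ∀ y κ, ‖A y κ‖ ≤ α) (y : Site d) (κ τ : Fin d) :
    ‖covDerivFwd η U₀ κ (fun z => A z τ) y‖ ≤ η⁻¹ * (2 * α) := by
  have h := norm_eta_smul_covDerivFwd_le hη.ne' h₀ hA y κ τ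
  rw [norm_smul, Real.norm_of_nonneg hη.le] at h
  rwa [le_inv_mul_iff₀ hη]

omit [CompleteSpace 𝔸] in
/-- `|∇^η_{U₀}A|_(−2)` IS A GENUINE SUPREMUM under (1.41): `(Lʲη)²|(D^η_{U₀,κ}A_τ)(y)| ≤ |∇^η_{U₀}A|_(−2)` for every
component. [cite: Balaban1985RegularSpaces, (1.55) p.86] -/
theorem le_gradNorm2 {η : ℝ} (hη : 0 < η) {U₀ : Site d → Fin d → 𝔸ˣ} (h₀ : ∀ y κ, U₀ y κ ∈ U1 𝔸)
    {A : Site d → Fin d → 𝔸} {α : ℝ} (hA : ∀ y κ, ‖A y κ‖ ≤ α) (L j : ℕ) (y : Site d) (κ τ : Fin d) :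
    ((L : ℝ) ^ j * η) ^ 2 * ‖covDerivFwd η U₀ κ (fun z => A z τ) y‖ ≤ gradNorm2 η L j U₀ A :=
  le_wsup (F := fun t : Fin d × Fin d × Site d => covDerivFwd η U₀ t.1 (fun z => A z t.2.1) t.2.2)
    (c := ((L : ℝ) ^ j * η) ^ 2 * (η⁻¹ * (2 * α)))
    (fun _ => mul_le_mul_of_nonneg_left (norm_covDerivFwd_le_of_141 hη h₀ hA _ _ _) (sq_nonneg _)) (κ, τ, y)

omit [CompleteSpace 𝔸] in
/-- The pointwise datum `G` of (1.54)/(1.55) from the norm: `|(D^η_{U₀,κ}A_τ)(y)| ≤ (Lʲη)⁻²|∇^η_{U₀}A|_(−2)` (`L ≥ 1`,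
`η > 0`). [cite: Balaban1985RegularSpaces, (1.55) p.86] -/
theorem norm_covDerivFwd_le_gradNorm2 {η : ℝ} (hη : 0 < η) {U₀ : Site d → Fin d → 𝔸ˣ} (h₀ : ∀ y κ, U₀ y κ ∈ U1 𝔸)
    {A : Site d → Fin d → 𝔸} {α : ℝ} (hA : ∀ y κ, ‖A y κ‖ ≤ α) {L : ℕ} (hL : 0 < L) (j : ℕ) (y : Site d)
    (κ τ : Fin d) :
    ‖covDerivFwd η U₀ κ (fun z => A z τ) y‖ ≤ (((L : ℝ) ^ j * η)⁻¹) ^ 2 * gradNorm2 η L j U₀ A := by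
  set s : ℝ := (L : ℝ) ^ j * η with hs
  have hs0 : 0 < s := by positivity
  have h := le_gradNorm2 hη h₀ hA L j y κ τ
  have h2 : 0 < s ^ 2 := by positivity
  rw [← mul_le_mul_iff_right₀ h2]
  calc s ^ 2 * ‖covDerivFwd η U₀ κ (fun z => A z τ) y‖ ≤ gradNorm2 η L j U₀ A := h
    _ = s ^ 2 * ((s⁻¹) ^ 2 * gradNorm2 η L j U₀ A) := by
        rw [← mul_assoc, ← mul_pow, mul_inv_cancel₀ hs0.ne', one_pow, one_mul]

/-- **(1.55), SECOND FORM** (level `j`, global): under the hypotheses of `eq154_printed` at every bond / plaquette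
and (1.9) for `U₁U₀` and `U₀` at every bond (`h40₁`, `h40₀`), `L ≥ 1`:
`|J|_(−3) ≤ 2α₀ + 36dα₂|∇^η_{U₀}A|_(−2) + 50dα₂³ + 10dα₀α₂`. [cite: Balaban1985RegularSpaces, (1.55) p.86] -/
theorem eq155_norm {η : ℝ} (hη : 0 < η) {U₀ : Site d → Fin d → 𝔸ˣ} (h₀ : ∀ y κ, U₀ y κ ∈ U1 𝔸)
    {A : Site d → Fin d → 𝔸} (h₁ : ∀ y κ, expCfg (iEta η A) y κ ∈ U1 𝔸) {L j : ℕ} (hL : 0 < L) {α₀ α₂ : ℝ}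
    (hα₀ : 0 ≤ α₀) (hα₂ : 0 ≤ α₂) (hA : ∀ y κ, ‖A y κ‖ ≤ α₂ * ((L : ℝ) ^ j * η)⁻¹)
    (hu : ∀ y κ, ‖(expCfg (iEta η A) y κ : 𝔸) - 1‖ ≤ α₂ * ((L : ℝ) ^ j * η)⁻¹ * η)
    (hp : ∀ (y : Site d) (κ ν : Fin d), κ ≠ ν → ‖plaqF U₀ κ ν y - 1‖ ≤ α₀ * η ^ 2 * (((L : ℝ) ^ j * η)⁻¹) ^ 2)
    (hsmall : 16 * (α₂ * ((L : ℝ) ^ j * η)⁻¹ * η) ≤ 1)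
    (hd : 5 * (α₂ * ((L : ℝ) ^ j * η)⁻¹ * η) * ((d : ℝ) - 1) ≤ 4)
    (h40₁ : ∀ (μ : Fin d) (x : Site d),
      ‖covDiv η (mulCfg (expCfg (iEta η A)) U₀) μ x‖ ≤ α₀ * η ^ 2 * (((L : ℝ) ^ j * η)⁻¹) ^ 3)
    (h40₀ : ∀ (μ : Fin d) (x : Site d), ‖covDiv η U₀ μ x‖ ≤ α₀ * η ^ 2 * (((L : ℝ) ^ j * η)⁻¹) ^ 3) :
    jNorm3 η L j U₀ A ≤ 2 * α₀ + 36 * d * α₂ * gradNorm2 η L j U₀ A + 50 * d * α₂ ^ 3 + 10 * d * α₀ * α₂ := by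
  set s : ℝ := (L : ℝ) ^ j * η with hs
  set g : ℝ := gradNorm2 η L j U₀ A with hg
  have hs0 : 0 < s := by positivity
  have hg0 : 0 ≤ g := gradNorm2_nonneg η L j U₀ A
  -- the pointwise datum `G = (Lʲη)⁻²·g`
  have hG : ∀ (y : Site d) (κ τ : Fin d), ‖covDerivFwd η U₀ κ (fun z => A z τ) y‖ ≤ (s⁻¹) ^ 2 * g :=
    fun y κ τ => norm_covDerivFwd_le_gradNorm2 hη h₀ hA hL j y κ τ
  have e : s ^ 2 * ((s⁻¹) ^ 2 * g) = g := by
    rw [← mul_assoc, ← mul_pow, mul_inv_cancel₀ hs0.ne', one_pow, one_mul]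
  refine wsup_le (fun b => ?_) (by positivity)
  have h := eq155_scaled hη h₀ h₁ hL hα₀ hα₂ hA hG hu hp hsmall hd b.1 b.2 (h40₁ b.1 b.2) (h40₀ b.1 b.2)
  rwa [e] at h

end Norms

/-! ## §4 The feed of (1.55) into the tree's bootstrap (1.59) ⇒ (1.60) (`B8.apriori_160`) -/

section Bootstrap

variable {𝔸 : Type*} [NormedRing 𝔸] [NormOneClass 𝔸] [NormedAlgebra ℂ 𝔸] [CompleteSpace 𝔸]

/-- **(1.55) ⇒ (1.59) ⇒ (1.60) with the certified suprema.**  With `nJ = |J|_(−3)` and `g = |∇^η_{U₀}A|_(−2)` the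
level-`j` global norms of §3 (so that (1.55) `h55` of `B8.apriori_160` is the THEOREM `eq155_norm`), (1.56) `|B₁| ≤
2dLα₁ + C₂α₂²` and the four bounds (1.59) `|A|_(−1), |∇^η_{U₀}A|_(−2), |D^{η*}D^ηA|_(−3), |Δ^ηA|_(−3) ≤ B₀(|J|_(−3) + |B₁|)`
(Theorem 3.3 of [4]) as real hypotheses, «B₀36dα₂ ≦ 1/2» and `50dα₂ ≤ 1`: the four bounds (1.60), in particular
`|∇^η_{U₀}A|_(−2) ≤ B₀(4α₀ + 4dLα₁ + 2α₂² + 20dα₀α₂ + 2C₂α₂²)`. [cite: Balaban1985RegularSpaces, (1.55)-(1.60) p.86] -/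
theorem apriori_160_of_155 {η : ℝ} (hη : 0 < η) {U₀ : Site d → Fin d → 𝔸ˣ} (h₀ : ∀ y κ, U₀ y κ ∈ U1 𝔸)
    {A : Site d → Fin d → 𝔸} (h₁ : ∀ y κ, expCfg (iEta η A) y κ ∈ U1 𝔸) {L j : ℕ} (hL : 0 < L) {α₀ α₂ : ℝ}
    (hα₀ : 0 ≤ α₀) (hα₂ : 0 ≤ α₂) (hA : ∀ y κ, ‖A y κ‖ ≤ α₂ * ((L : ℝ) ^ j * η)⁻¹)
    (hu : ∀ y κ, ‖(expCfg (iEta η A) y κ : 𝔸) - 1‖ ≤ α₂ * ((L : ℝ) ^ j * η)⁻¹ * η)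
    (hp : ∀ (y : Site d) (κ ν : Fin d), κ ≠ ν → ‖plaqF U₀ κ ν y - 1‖ ≤ α₀ * η ^ 2 * (((L : ℝ) ^ j * η)⁻¹) ^ 2)
    (hsmall : 16 * (α₂ * ((L : ℝ) ^ j * η)⁻¹ * η) ≤ 1)
    (hd : 5 * (α₂ * ((L : ℝ) ^ j * η)⁻¹ * η) * ((d : ℝ) - 1) ≤ 4)
    (h40₁ : ∀ (μ : Fin d) (x : Site d),
      ‖covDiv η (mulCfg (expCfg (iEta η A)) U₀) μ x‖ ≤ α₀ * η ^ 2 * (((L : ℝ) ^ j * η)⁻¹) ^ 3)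
    (h40₀ : ∀ (μ : Fin d) (x : Site d), ‖covDiv η U₀ μ x‖ ≤ α₀ * η ^ 2 * (((L : ℝ) ^ j * η)⁻¹) ^ 3)
    {C₂ B₀ α₁ nB a j₂ l : ℝ} (hB₀ : 0 ≤ B₀) (h56 : nB ≤ 2 * d * L * α₁ + C₂ * α₂ ^ 2)
    (h59a : a ≤ B₀ * (jNorm3 η L j U₀ A + nB)) (h59g : gradNorm2 η L j U₀ A ≤ B₀ * (jNorm3 η L j U₀ A + nB))
    (h59j : j₂ ≤ B₀ * (jNorm3 η L j U₀ A + nB)) (h59l : l ≤ B₀ * (jNorm3 η L j U₀ A + nB))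
    (hside : 36 * d * B₀ * α₂ ≤ 1 / 2) (h50 : 50 * d * α₂ ≤ 1) :
    a ≤ B₀ * (4 * α₀ + 4 * d * L * α₁ + 2 * α₂ ^ 2 + 20 * d * α₀ * α₂ + 2 * C₂ * α₂ ^ 2) ∧
    gradNorm2 η L j U₀ A ≤ B₀ * (4 * α₀ + 4 * d * L * α₁ + 2 * α₂ ^ 2 + 20 * d * α₀ * α₂ + 2 * C₂ * α₂ ^ 2) ∧
    j₂ ≤ B₀ * (4 * α₀ + 4 * d * L * α₁ + 2 * α₂ ^ 2 + 20 * d * α₀ * α₂ + 2 * C₂ * α₂ ^ 2) ∧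
    l ≤ B₀ * (4 * α₀ + 4 * d * L * α₁ + 2 * α₂ ^ 2 + 20 * d * α₀ * α₂ + 2 * C₂ * α₂ ^ 2) :=
  B8.apriori_160 (Nat.cast_nonneg d) hB₀ hα₂ (gradNorm2_nonneg η L j U₀ A)
    (eq155_norm hη h₀ h₁ hL hα₀ hα₂ hA hu hp hsmall hd h40₁ h40₀) h56 h59a h59g h59j h59l hside h50

end Bootstrap

/-! ## §5 The Hermitian case of (1.41) in a C⋆-algebra: `e^{iηA}` is unitary and `|e^{iηA} − 1| ≤ η|A|` -/

section Hermitian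

open Complex

variable {𝔸 : Type*} [CStarAlgebra 𝔸]

/-- `iηX = i·(ηX)` with the real scalar cast into `ℂ`. [folklore] -/
theorem I_eta_smul_eq (η : ℝ) (X : 𝔸) : ((I : ℂ) * η) • X = (I : ℂ) • ((η : ℂ) • X) := by
  rw [smul_smul]

/-- `ηX` is self-adjoint for `X` self-adjoint and `η` real. [folklore] -/
theorem isSelfAdjoint_real_smul (η : ℝ) {X : 𝔸} (hX : IsSelfAdjoint X) : IsSelfAdjoint ((η : ℂ) • X) :=
  IsSelfAdjoint.smul (Complex.conj_ofReal η) hX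

/-- «U₁ = e^{iηA}» (1.41) with `A(b)` Hermitian: `e^{iηA(b)}` is unitary. [cite: Balaban1985RegularSpaces, (1.41) p.83] -/
theorem expCfg_iEta_mem_unitaryUnits (η : ℝ) {A : Site d → Fin d → 𝔸} (hA : ∀ y κ, IsSelfAdjoint (A y κ))
    (y : Site d) (κ : Fin d) : expCfg (iEta η A) y κ ∈ B7Prop2Explicit.unitaryUnits 𝔸 := by
  rw [B7Prop2Explicit.mem_unitaryUnits]
  show exp (((I : ℂ) * η) • A y κ) ∈ unitary 𝔸
  rw [I_eta_smul_eq]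
  exact B8Ineq170.exp_I_smul_mem_unitary (isSelfAdjoint_real_smul η (hA y κ))

variable [Nontrivial 𝔸]

/-- «U₁ = e^{iηA}» (1.41) with `A(b)` Hermitian: `e^{iηA(b)}` lies in `{|u| ≤ 1, |u⁻¹| ≤ 1}` — the hypothesis `h₁` of
`eq154_printed` / `eq155_printed` is discharged. [cite: Balaban1985RegularSpaces, (1.41) p.83; Balaban1985Averaging, (19) p.21] -/
theorem expCfg_iEta_mem_U1 (η : ℝ) {A : Site d → Fin d → 𝔸} (hA : ∀ y κ, IsSelfAdjoint (A y κ)) (y : Site d)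
    (κ : Fin d) : expCfg (iEta η A) y κ ∈ U1 𝔸 :=
  B7Prop2Explicit.unitaryUnits_le_U1 (expCfg_iEta_mem_unitaryUnits η hA y κ)

omit [Nontrivial 𝔸] in
/-- «∂_{U₀}U₁ − 1 = O₁(4α₂(Lʲη)⁻¹η)»'s one-link input for Hermitian `A(b)`: `|e^{iηA(b)} − 1| ≤ η|A(b)|` (`η ≥ 0`;
(24) of [3]). [cite: Balaban1985Averaging, (24) p.21; Balaban1985RegularSpaces, (1.41) p.83] -/
theorem norm_expCfg_iEta_sub_one_le {η : ℝ} (hη : 0 ≤ η) {A : Site d → Fin d → 𝔸}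
    (hA : ∀ y κ, IsSelfAdjoint (A y κ)) (y : Site d) (κ : Fin d) :
    ‖(expCfg (iEta η A) y κ : 𝔸) - 1‖ ≤ η * ‖A y κ‖ := by
  show ‖exp (((I : ℂ) * η) • A y κ) - 1‖ ≤ η * ‖A y κ‖
  rw [I_eta_smul_eq]
  refine (B8Ineq170.norm_exp_I_smul_sub_one_le (isSelfAdjoint_real_smul η (hA y κ))).trans_eq ?_
  rw [norm_smul, Complex.norm_real, Real.norm_of_nonneg hη]

omit [Nontrivial 𝔸] in
/-- The hypothesis `hu` of `eq154_printed` / `eq155_printed` is discharged for Hermitian `A` with (1.41):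
`|e^{iηA(b)} − 1| ≤ α₂(Lʲη)⁻¹η`. [cite: Balaban1985RegularSpaces, (1.41) p.83] -/
theorem norm_expCfg_iEta_sub_one_le_of_141 {η : ℝ} (hη : 0 ≤ η) {A : Site d → Fin d → 𝔸}
    (hA : ∀ y κ, IsSelfAdjoint (A y κ)) {L j : ℕ} {α₂ : ℝ} (hAb : ∀ y κ, ‖A y κ‖ ≤ α₂ * ((L : ℝ) ^ j * η)⁻¹)
    (y : Site d) (κ : Fin d) : ‖(expCfg (iEta η A) y κ : 𝔸) - 1‖ ≤ α₂ * ((L : ℝ) ^ j * η)⁻¹ * η :=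
  (norm_expCfg_iEta_sub_one_le hη hA y κ).trans
    ((mul_le_mul_of_nonneg_left (hAb y κ) hη).trans_eq (mul_comm _ _))

/-- **(1.54) FOR HERMITIAN `A`** — the parent's `eq154_printed` with its two ASSUMED hypotheses on `U₁ = e^{iηA}`
(`U1`-valued, `|U₁ − 1| ≤ α₂(Lʲη)⁻¹η`) DISCHARGED. [cite: Balaban1985RegularSpaces, (1.54) p.85] -/
theorem eq154_hermitian {η : ℝ} (hη : 0 < η) {U₀ : Site d → Fin d → 𝔸ˣ} (h₀ : ∀ y κ, U₀ y κ ∈ U1 𝔸)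
    {A : Site d → Fin d → 𝔸} (hAh : ∀ y κ, IsSelfAdjoint (A y κ)) {L j : ℕ} {α₀ α₂ G : ℝ}
    (hα₀ : 0 ≤ α₀) (hα₂ : 0 ≤ α₂) (hA : ∀ y κ, ‖A y κ‖ ≤ α₂ * ((L : ℝ) ^ j * η)⁻¹)
    (hG : ∀ (y : Site d) (κ τ : Fin d), ‖covDerivFwd η U₀ κ (fun z => A z τ) y‖ ≤ G)
    (hp : ∀ (y : Site d) (κ ν : Fin d), κ ≠ ν → ‖plaqF U₀ κ ν y - 1‖ ≤ α₀ * η ^ 2 * (((L : ℝ) ^ j * η)⁻¹) ^ 2)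
    (hsmall : 16 * (α₂ * ((L : ℝ) ^ j * η)⁻¹ * η) ≤ 1)
    (hd : 5 * (α₂ * ((L : ℝ) ^ j * η)⁻¹ * η) * ((d : ℝ) - 1) ≤ 4) (μ : Fin d) (x : Site d) :
    ‖covDiv η (mulCfg (expCfg (iEta η A)) U₀) μ x - covDiv η U₀ μ x -
        ((Complex.I : ℂ) * η ^ 2) • pdiv η U₀ (plaqCovDeriv η U₀ A) μ x‖ ≤
      36 * d * (α₂ * ((L : ℝ) ^ j * η)⁻¹) * G * η ^ 2 + 50 * d * α₂ ^ 3 * (((L : ℝ) ^ j * η)⁻¹) ^ 3 * η ^ 2 +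
        10 * d * α₀ * α₂ * (((L : ℝ) ^ j * η)⁻¹) ^ 3 * η ^ 2 :=
  eq154_printed hη h₀ (expCfg_iEta_mem_U1 η hAh) hα₀ hα₂ hA hG
    (norm_expCfg_iEta_sub_one_le_of_141 hη.le hAh hA) hp hsmall hd μ x

/-- **(1.55), FIRST FORM, FOR HERMITIAN `A`** (`h₁`, `hu` discharged). [cite: Balaban1985RegularSpaces, (1.55) p.86] -/
theorem eq155_hermitian {η : ℝ} (hη : 0 < η) {U₀ : Site d → Fin d → 𝔸ˣ} (h₀ : ∀ y κ, U₀ y κ ∈ U1 𝔸)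
    {A : Site d → Fin d → 𝔸} (hAh : ∀ y κ, IsSelfAdjoint (A y κ)) {L j : ℕ} {α₀ α₂ G : ℝ}
    (hα₀ : 0 ≤ α₀) (hα₂ : 0 ≤ α₂) (hA : ∀ y κ, ‖A y κ‖ ≤ α₂ * ((L : ℝ) ^ j * η)⁻¹)
    (hG : ∀ (y : Site d) (κ τ : Fin d), ‖covDerivFwd η U₀ κ (fun z => A z τ) y‖ ≤ G)
    (hp : ∀ (y : Site d) (κ ν : Fin d), κ ≠ ν → ‖plaqF U₀ κ ν y - 1‖ ≤ α₀ * η ^ 2 * (((L : ℝ) ^ j * η)⁻¹) ^ 2)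
    (hsmall : 16 * (α₂ * ((L : ℝ) ^ j * η)⁻¹ * η) ≤ 1)
    (hd : 5 * (α₂ * ((L : ℝ) ^ j * η)⁻¹ * η) * ((d : ℝ) - 1) ≤ 4) (μ : Fin d) (x : Site d)
    (h40₁ : ‖covDiv η (mulCfg (expCfg (iEta η A)) U₀) μ x‖ ≤ α₀ * η ^ 2 * (((L : ℝ) ^ j * η)⁻¹) ^ 3)
    (h40₀ : ‖covDiv η U₀ μ x‖ ≤ α₀ * η ^ 2 * (((L : ℝ) ^ j * η)⁻¹) ^ 3) :
    ‖Jcur η U₀ A μ x‖ ≤ (2 * α₀ + 36 * d * α₂ * (((L : ℝ) ^ j * η) ^ 2 * G) + 50 * d * α₂ ^ 3 +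
        10 * d * α₀ * α₂) * (((L : ℝ) ^ j * η)⁻¹) ^ 3 :=
  eq155_printed hη h₀ (expCfg_iEta_mem_U1 η hAh) hα₀ hα₂ hA hG
    (norm_expCfg_iEta_sub_one_le_of_141 hη.le hAh hA) hp hsmall hd μ x h40₁ h40₀

/-- **(1.55), SECOND FORM, FOR HERMITIAN `A`** (`h₁`, `hu` discharged; level `j`, global, `L ≥ 1`).
[cite: Balaban1985RegularSpaces, (1.55) p.86] -/
theorem eq155_norm_hermitian {η : ℝ} (hη : 0 < η) {U₀ : Site d → Fin d → 𝔸ˣ} (h₀ : ∀ y κ, U₀ y κ ∈ U1 𝔸)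
    {A : Site d → Fin d → 𝔸} (hAh : ∀ y κ, IsSelfAdjoint (A y κ)) {L j : ℕ} (hL : 0 < L) {α₀ α₂ : ℝ}
    (hα₀ : 0 ≤ α₀) (hα₂ : 0 ≤ α₂) (hA : ∀ y κ, ‖A y κ‖ ≤ α₂ * ((L : ℝ) ^ j * η)⁻¹)
    (hp : ∀ (y : Site d) (κ ν : Fin d), κ ≠ ν → ‖plaqF U₀ κ ν y - 1‖ ≤ α₀ * η ^ 2 * (((L : ℝ) ^ j * η)⁻¹) ^ 2)
    (hsmall : 16 * (α₂ * ((L : ℝ) ^ j * η)⁻¹ * η) ≤ 1)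
    (hd : 5 * (α₂ * ((L : ℝ) ^ j * η)⁻¹ * η) * ((d : ℝ) - 1) ≤ 4)
    (h40₁ : ∀ (μ : Fin d) (x : Site d),
      ‖covDiv η (mulCfg (expCfg (iEta η A)) U₀) μ x‖ ≤ α₀ * η ^ 2 * (((L : ℝ) ^ j * η)⁻¹) ^ 3)
    (h40₀ : ∀ (μ : Fin d) (x : Site d), ‖covDiv η U₀ μ x‖ ≤ α₀ * η ^ 2 * (((L : ℝ) ^ j * η)⁻¹) ^ 3) :
    jNorm3 η L j U₀ A ≤ 2 * α₀ + 36 * d * α₂ * gradNorm2 η L j U₀ A + 50 * d * α₂ ^ 3 + 10 * d * α₀ * α₂ :=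
  eq155_norm hη h₀ (expCfg_iEta_mem_U1 η hAh) hL hα₀ hα₂ hA (norm_expCfg_iEta_sub_one_le_of_141 hη.le hAh hA)
    hp hsmall hd h40₁ h40₀

end Hermitian

#print axioms eq155
#print axioms eq155_printed
#print axioms eq155_scaled
#print axioms eq155_norm
#print axioms apriori_160_of_155
#print axioms expCfg_iEta_mem_U1
#print axioms norm_expCfg_iEta_sub_one_le
#print axioms eq154_hermitian
#print axioms eq155_hermitian
#print axioms eq155_norm_hermitian

end Literature.MathematicalPhysics.QuantumFieldTheory.Balaban1983to89.B8Eq155JBound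

end
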